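import Summits.BirchSwinnertonDyer.BirchSwinnertonDyer.Theorems.ErratumRoadFiveAuxNormReceptacle
import Summits.BirchSwinnertonDyer.BirchSwinnertonDyer.Theorems.ErratumRoadFiveAuxNormRelativeStabilizerLaw
import HarnessLib

/-!
# Route `ErratumRoadFive` (K2, `p ≥ 5`), crux `EulerHalfNotRamNoInertSetAtFive` (item stmt-BirchSwinnertonDyer-19715), line `birth` v15:
# THE AUXILIARY-NORM LEVER FROM THE K-LINEAR TATE COMPONENT FAMILY (S1-lin), AND WITH S2♭ DISCHARGED BY THE TREE
# (cell `bsd-stepL`, LEAD `bsd-line-er5-p1` g3; `--supports stmt-BirchSwinnertonDyer-19715 --as helper`)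

WHY. The S1 prover (width seat -w3 g6, HOME STATUS 2026-08-28T15:09:03Z) builds the Tate component characters LOCALLY at the places `v ∣ q` of `K`
(`exists_componentHom_of_tateNormalForm` p642730, `TateComponent.exists_componentHom_localPoints` p643753) and pulls them back along K-embeddings
`K[n] → K̄_v`; Galois covariance (K3) then holds for the K-LINEAR automorphisms `τ ∈ ringClassGal ι n` — which is all the composition uses ((K3) is
applied at `τ = σ^i ∈ ringClassGalOver ι (ℓ₀m₀) m₀ ≤ ringClassGal ι (ℓ₀m₀)`). The ideator typed this as `TateComponentFamilyLinear` (v5 of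
`Lines/aux_norm_receptacle.lean`, bsd-idea-9 g9; Defs addendum p644945) and proved §2 from it; this file is the tree's copy, so that skeleton v15
registers `stub_tateComponentFamilyLinear` (the weaker, construction-shaped text) instead of the `Aut_ℚ`-covariant `TateComponentFamily`.
S2♭ `RelativeStabilizerLaw K ι q` is a THEOREM of the tree since 14:48Z (width seat -w4 g8, `AuxNormReceptacle.relativeStabilizerLaw`, p642411;
statement byte-identical to the def body), so the frame binder `hE0T` follows from THREE leaf statements: S1-lin, (C), (O).

WHAT (sorry-free; VERBATIM from v5 where marked).
* `tateComponentFamilyLinear_of` : S1 → S1-lin (v5).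
* `labelE0Prime_at_splitCarrier_of_linear` : S1-lin → S3 → (B4) of `LabelsAt` → `p ∣ c_q` → the E′-label at `q` (v5 VERBATIM; = the proof of
  `labelE0Prime_at_splitCarrier_of_stubs` with (K3) invoked through `ringClassGalOver_le_ringClassGal`).
* `labelE0Prime_at_splitCarrier_of_linearLaws` : S1-lin → S2♭ → S3♭ → … (glue `auxiliaryInertLevel_of_laws`).
* `carrierLabelsE0Prime_of_linearLeaves` : the `hE0T` binder on a `p ≥ 5` frame from S1-lin, S2♭, (C), (O).
* `carrierLabelsE0Prime_of_threeLeaves` : the same from S1-lin, (C), (O) — S2♭ supplied by `AuxNormReceptacle.relativeStabilizerLaw` (p642411).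

HONEST FRAMING: THEOREMS ONLY, CONDITIONAL on the displayed leaf statements (REGISTERED stubs of skeleton v15; not proved here); no `sorry`, no definition,
no named fact; item 19715 is NOT closed by this file; no census number moves; BSD is proved for no curve; no summit statement is touched.
[cite: GrossLMS1991, §3 Prop. 3.7 (1), §4 (𝒢_n), §6 proof of Prop. 6.2 (1) (p. 245)] [cite: SilvermanATAEC1994, IV Cor. 9.2 (d), V Thm. 3.1]
[cite: Cox2013, §7.D Thm. 7.24, Thm. 8.12, §9.A] [cite: NeukirchANT1999, Ch. VI §7 Thm. (7.3)]
-/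

set_option autoImplicit false
set_option linter.dupNamespace false -- `Summit.BirchSwinnertonDyer.BirchSwinnertonDyer` (summit = problem), tree-wide

noncomputable section

open scoped Classical NumberField Pointwise

namespace Summit.BirchSwinnertonDyer.BirchSwinnertonDyer.Theorems.AuxNormReceptacle

open WeierstrassCurve IsDedekindDomain NumberField Field Literature.NumberTheory.EllipticCurves
  Literature.NumberTheory.GaloisRepresentations Summit.BirchSwinnertonDyer.Rank1Residual.X11b
  Summit.BirchSwinnertonDyer.BirchSwinnertonDyer.Theorems Rat.HeightOneSpectrum
  Literature.NumberTheory.NumberFields Literature.NumberTheory.NumberFields.RingClassField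
  Literature.NumberTheory.QuadraticFields.RingClass

section Linear

variable (W : WeierstrassCurve ℚ) [W.IsElliptic] [W.IsGloballyMinimal] (K : Type) [Field K] [NumberField K]
  (ι : K →+* ℂ)

omit [W.IsElliptic] in
/-- S1 ⟹ S1-lin (drop the hypothesis `τ ∈ ringClassGal ι n`). [folklore] -/
theorem tateComponentFamilyLinear_of [∀ j : ℕ, NumberField (ringClassField K ι j)] {q : ℕ}
    (h : TateComponentFamily W K ι q) : TateComponentFamilyLinear W K ι q := by
  obtain ⟨comp, h1, h2, h3⟩ := h
  exact ⟨comp, h1, h2, fun n hn hqn τ w w' _ hw P ↦ h3 n hn hqn τ w w' hw P⟩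

end Linear

/-! ## §2-lin The composition from S1-lin (v5 VERBATIM) -/

section Composition

variable (W : WeierstrassCurve ℚ) [W.IsElliptic] [W.IsGloballyMinimal] {K : Type} [Field K] [NumberField K]
  (ι : K →+* ℂ)

set_option maxHeartbeats 1600000 in
/-- (v5: stated over the K-LINEAR form `TateComponentFamilyLinear` of S1 — the proof uses (K3) only at `τ = σ^i ∈ ringClassGalOver ≤ ringClassGal`;
the v2–v4 statement over `TateComponentFamily` follows as `labelE0Prime_at_splitCarrier_of_stubs` right below.)
**The E′-label at a K-split multiplicative carrier from the two stubs.** On `K` imaginary quadratic with the ring class tower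
`K[·] ⊂ ℂ`, a prime `p ≥ 5`, a prime `q ∣ N` with `p ∣ c_q(E/ℚ_q)`, a family `ys` carrying Gross's norm relation (B4) (the fifth
conjunct of `ShimuraWalk.LabelsAt`), the statements S1 (at `q`) and S3 (at `p, q, N`): there is ONE `n'` prime to `p` (namely
`c_q / p^{ord_p c_q}`) with `n' • ys m ∈ E₀(K[m])_w` at every guarded level `m` and every place `w ∋ q` — VERBATIM the conclusion of
the binder `hE0T` of `ShimuraKolyvaginOfImage.exists_uniform_exponent_of_carrierLabelsE0Prime` at `q`. Proof: §0 (A3) applied to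
(B4) at the auxiliary level `ℓ₀ m` of S3 read through the component character of S1 at a place `w̃ ∣ w`.
[cite: GrossLMS1991, §3 Prop. 3.7 (1), §6 p. 245] [cite: SilvermanATAEC1994, IV Cor. 9.2 (d)] -/
theorem labelE0Prime_at_splitCarrier_of_linear [∀ j : ℕ, NumberField (ringClassField K ι j)]
    (hK : IsImaginaryQuadratic K) {p : ℕ} [Fact p.Prime] (hp5 : 5 ≤ p) {q : ℕ} [Fact q.Prime] {N : ℕ} (hqN : q ∣ N)
    (hS1 : TateComponentFamilyLinear W K ι q) (hS3 : AuxiliaryInertLevel W K ι p q N)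
    (ys : (m : ℕ) → (W.baseChange (ringClassField K ι m)).toAffine.Point)
    {y : (W.baseChange K).toAffine.Point} {ε : ℤ} (hLab : ShimuraWalk.LabelsAt W N K ι y ys ε)
    (htam : p ∣ (W.baseChange ℚ_[q]).localTamagawaNumber ℤ_[q]) :
    ∃ n' : ℕ, ¬ p ∣ n' ∧ ∀ m : ℕ, Squarefree m → (∀ r ∈ m.primeFactors, ¬ r ∣ N ∧ (Ideal.span {(r : 𝓞 K)}).IsPrime) →
      ∀ [NumberField (ringClassField K ι m)] (w : HeightOneSpectrum (𝓞 (ringClassField K ι m))),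
        ((q : ℕ) : 𝓞 (ringClassField K ι m)) ∈ w.asIdeal →
        (placeIntModel W (ringClassField K ι m) w).HasNonsingularReduction (K := ringClassField K ι m) (n' • ys m) := by
  have hp : p.Prime := Fact.out
  have hq : q.Prime := Fact.out
  -- `q` is split multiplicative and `c := ord_q Δ_min = c_q ≠ 0`, `p ∣ c`
  haveI : (W.baseChange ℚ_[q]).IsElliptic := inferInstanceAs (W.map (algebraMap ℚ ℚ_[q])).IsElliptic
  have hs : W.HasSplitMultiplicativeReductionAtPrime q :=
    hasSplitMultiplicativeReduction_of_five_le_of_dvd_localTamagawaNumber q (W.baseChange ℚ_[q]) hp5 htam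
  obtain ⟨v, hv⟩ : ∃ v : HeightOneSpectrum ℤ, (primesEquiv v : ℕ) = q :=
    ⟨primesEquiv.symm ⟨q, hq⟩, by rw [Equiv.apply_symm_apply]⟩
  have hcq : (W.baseChange ℚ_[q]).localTamagawaNumber ℤ_[q] = padicValInt q W.minimalDiscriminantInt :=
    localTamagawaNumber_eq_padicValInt_of_split W v hv hs
  have hc0 : padicValInt q W.minimalDiscriminantInt ≠ 0 := by
    rw [← hcq]; exact localTamagawaNumber_padic_ne_zero_holds q (W.baseChange ℚ_[q])
  have hpc : p ∣ padicValInt q W.minimalDiscriminantInt := by rw [← hcq]; exact htam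
  have hpe : p ^ (padicValInt q W.minimalDiscriminantInt).factorization p ∣ padicValInt q W.minimalDiscriminantInt :=
    Nat.ordProj_dvd _ _
  obtain ⟨comp, hK1, hK2, hK3⟩ := hS1
  refine ⟨padicValInt q W.minimalDiscriminantInt / p ^ (padicValInt q W.minimalDiscriminantInt).factorization p,
    Nat.not_dvd_ordCompl hp hc0, fun m₀ hm₀ hg₀ _ w₀ hw₀ ↦ ?_⟩
  -- the auxiliary level `ℓ₀ m₀`
  obtain ⟨ℓ₀, hℓ₀, hℓ₀N, hℓ₀m, hℓ₀P, haℓ, hgrp⟩ :=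
    hS3 ((padicValInt q W.minimalDiscriminantInt).factorization p) m₀ hm₀ hg₀
  have hm0 : m₀ ≠ 0 := hm₀.ne_zero
  have hM0 : ℓ₀ * m₀ ≠ 0 := mul_ne_zero hℓ₀.ne_zero hm0
  have hqm : ¬ q ∣ m₀ := fun h ↦ (hg₀ q (Nat.mem_primeFactors.mpr ⟨hq, h, hm0⟩)).1 hqN
  have hqℓ : q ≠ ℓ₀ := fun h ↦ hℓ₀N (h ▸ hqN)
  have hqM : ¬ q ∣ ℓ₀ * m₀ := fun h ↦ ((Nat.Prime.dvd_mul hq).mp h).elim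
    (fun h1 ↦ hqℓ ((Nat.prime_dvd_prime_iff_eq hq hℓ₀).mp h1)) hqm
  have hsqM : Squarefree (ℓ₀ * m₀) :=
    (Nat.squarefree_mul ((Nat.Prime.coprime_iff_not_dvd hℓ₀).mpr hℓ₀m)).mpr ⟨hℓ₀.prime.squarefree, hm₀⟩
  have hgM : ∀ r ∈ (ℓ₀ * m₀).primeFactors, ¬ r ∣ N ∧ (Ideal.span {(r : 𝓞 K)}).IsPrime := by
    intro r hr
    rw [Nat.primeFactors_mul hℓ₀.ne_zero hm0, Finset.mem_union] at hr
    rcases hr with hr | hr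
    · rw [hℓ₀.primeFactors, Finset.mem_singleton] at hr
      subst hr
      exact ⟨hℓ₀N, hℓ₀P⟩
    · exact hg₀ r hr
  have hℓmem : ℓ₀ ∈ (ℓ₀ * m₀).primeFactors := Nat.mem_primeFactors.mpr ⟨hℓ₀, dvd_mul_right _ _, hM0⟩
  -- a generator `σ` of `G_{ℓ₀}`; work at the level pair `(ℓ₀ m₀, ℓ₀ m₀ / ℓ₀)` and transport to `m₀` at the end
  obtain ⟨σ, hσ⟩ := RingClassGalOverCyclic.exists_zpowers_eq_ringClassGalOver_mul hK ι hm0 hℓ₀ hℓ₀m hℓ₀P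
  obtain ⟨hσn, hstab⟩ := hgrp σ hσ
  have hdiv : ℓ₀ * m₀ / ℓ₀ = m₀ := Nat.mul_div_cancel_left m₀ hℓ₀.pos
  have hle' : ringClassField K ι (ℓ₀ * m₀ / ℓ₀) ≤ ringClassField K ι (ℓ₀ * m₀) :=
    ringClassField_div_le hK ι (dvd_mul_right ℓ₀ m₀) hM0
  have hσ' : Subgroup.zpowers σ = ringClassGalOver ι (ℓ₀ * m₀) (ℓ₀ * m₀ / ℓ₀) := by rw [hdiv]; exact hσ
  have hm0' : ℓ₀ * m₀ / ℓ₀ ≠ 0 := by rw [hdiv]; exact hm0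
  have hqm' : ¬ q ∣ ℓ₀ * m₀ / ℓ₀ := by rw [hdiv]; exact hqm
  -- (B4) at level `ℓ₀ m₀` with `ℓ = ℓ₀`
  have h4 := hLab.2.2.2.2.1 (ℓ₀ * m₀) hsqM hgM ℓ₀ hℓmem hle' σ hσ'
  obtain ⟨f, h4f, hfcoe⟩ : ∃ f : ringClassField K ι (ℓ₀ * m₀ / ℓ₀) →ₐ[ℚ] ringClassField K ι (ℓ₀ * m₀),
      _ = W.frobeniusTrace ℓ₀ • WeierstrassCurve.Affine.Point.map (W' := W) f (ys (ℓ₀ * m₀ / ℓ₀)) ∧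
      (∀ x : ringClassField K ι (ℓ₀ * m₀ / ℓ₀), ((f x : ringClassField K ι (ℓ₀ * m₀)) : ℂ) = (x : ℂ)) :=
    ⟨_, h4, fun x ↦ RingClassField.coe_inclusion ι hle' x⟩
  -- the E′-label at level `ℓ₀ m₀ / ℓ₀`, every place `w₁ ∋ q`
  have hfin : ∀ (w₁ : HeightOneSpectrum (𝓞 (ringClassField K ι (ℓ₀ * m₀ / ℓ₀)))),
      ((q : ℕ) : 𝓞 (ringClassField K ι (ℓ₀ * m₀ / ℓ₀))) ∈ w₁.asIdeal →
      (placeIntModel W (ringClassField K ι (ℓ₀ * m₀ / ℓ₀)) w₁).HasNonsingularReduction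
        (K := ringClassField K ι (ℓ₀ * m₀ / ℓ₀))
        ((padicValInt q W.minimalDiscriminantInt / p ^ (padicValInt q W.minimalDiscriminantInt).factorization p) •
          ys (ℓ₀ * m₀ / ℓ₀)) := by
    intro w₁ hw₁
    -- a place `w̃ ∣ w₁` of `K[ℓ₀ m₀]` with compatible component characters (K2)
    obtain ⟨wt, hwtq, hwt⟩ := hK2 (ℓ₀ * m₀) (ℓ₀ * m₀ / ℓ₀) hM0 hqM (Nat.div_dvd_of_dvd (dvd_mul_right ℓ₀ m₀))
      f hfcoe w₁ hw₁
    -- read (B4) through `comp_{w̃}`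
    have key := congrArg (comp (ℓ₀ * m₀) wt) h4f
    rw [map_sum, map_zsmul, hwt (ys (ℓ₀ * m₀ / ℓ₀))] at key
    -- the conjugate places `σ^{-i} w̃`, as a function `F` on ideals
    set F : Ideal (𝓞 (ringClassField K ι (ℓ₀ * m₀))) → ZMod (padicValInt q W.minimalDiscriminantInt) :=
      fun I ↦ if h : I.IsPrime ∧ I ≠ ⊥ then comp (ℓ₀ * m₀) ⟨I, h.1, h.2⟩ (ys (ℓ₀ * m₀)) else 0 with hFdef
    have hI : ∀ i : ℕ, ((σ ^ i)⁻¹ • wt.asIdeal).IsPrime ∧ (σ ^ i)⁻¹ • wt.asIdeal ≠ ⊥ := by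
      intro i
      refine ⟨(Ideal.IsPrime.smul_iff _).mpr wt.isPrime, fun h ↦ wt.ne_bot ?_⟩
      have := congrArg (fun J : Ideal (𝓞 (ringClassField K ι (ℓ₀ * m₀))) ↦ (σ ^ i) • J) h
      simpa only [smul_inv_smul, Ideal.smul_bot] using this
    have hF : ∀ i : ℕ, F ((σ ^ i)⁻¹ • wt.asIdeal) = comp (ℓ₀ * m₀) ⟨_, (hI i).1, (hI i).2⟩ (ys (ℓ₀ * m₀)) :=
      fun i ↦ by rw [hFdef]; exact dif_pos (hI i)
    have key2 : ∑ i ∈ Finset.range (ℓ₀ + 1), F ((σ ^ i)⁻¹ • wt.asIdeal) =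
        W.frobeniusTrace ℓ₀ • comp (ℓ₀ * m₀ / ℓ₀) w₁ (ys (ℓ₀ * m₀ / ℓ₀)) := by
      rw [← key]
      refine Finset.sum_congr rfl fun i _ ↦ ?_
      rw [hF i]
      -- v5: only the K-linear part of (K3) is used: `σ ^ i ∈ G_{ℓ₀} = ringClassGalOver ι (ℓ₀m₀) m₀ ≤ 𝒢 = ringClassGal ι (ℓ₀m₀)`
      exact (hK3 (ℓ₀ * m₀) hM0 hqM (σ ^ i) wt ⟨_, (hI i).1, (hI i).2⟩
        (ringClassGalOver_le_ringClassGal ι (ℓ₀ * m₀) m₀ (hσ.le (Subgroup.npow_mem_zpowers σ i)))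
        (smul_inv_smul (σ ^ i) wt.asIdeal).symm (ys (ℓ₀ * m₀))).symm
    -- (A3): `(c / p^e) • comp_{w₁}(ys _) = 0`
    have hap : IsCoprime (W.frobeniusTrace ℓ₀) (p : ℤ) :=
      ((Prime.coprime_iff_not_dvd (Nat.prime_iff_prime_int.mp hp)).mpr haℓ).symm
    have hkill := div_pow_smul_eq_zero_of_sum_range σ hσn wt.asIdeal F hap hpe (hstab wt hwtq) key2
    -- conclude by (K1) at `w₁`
    refine (hK1 (ℓ₀ * m₀ / ℓ₀) hm0' hqm' w₁ hw₁ _).mp ?_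
    rw [map_nsmul]
    exact hkill
  rw [hdiv] at hfin
  exact hfin w₀ hw₀

/-- **The E′-label at a K-split carrier from S1-lin, S2♭, S3♭** (the glue `auxiliaryInertLevel_of_laws` inserted).
[cite: GrossLMS1991, §3 Prop. 3.7 (1), §6 p. 245] [cite: NeukirchANT1999, Ch. VI §7 Thm. (7.3)] -/
theorem labelE0Prime_at_splitCarrier_of_linearLaws [∀ j : ℕ, NumberField (ringClassField K ι j)]
    (hK : IsImaginaryQuadratic K) {p : ℕ} [Fact p.Prime] (hp5 : 5 ≤ p) {q : ℕ} [Fact q.Prime] {N : ℕ} (hqN : q ∣ N)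
    (hS1 : TateComponentFamilyLinear W K ι q) (hS2 : RelativeStabilizerLaw K ι q) (hS3 : AuxiliaryPrimeSupply W K p q N)
    (ys : (m : ℕ) → (W.baseChange (ringClassField K ι m)).toAffine.Point)
    {y : (W.baseChange K).toAffine.Point} {ε : ℤ} (hLab : ShimuraWalk.LabelsAt W N K ι y ys ε)
    (htam : p ∣ (W.baseChange ℚ_[q]).localTamagawaNumber ℤ_[q]) :
    ∃ n' : ℕ, ¬ p ∣ n' ∧ ∀ m : ℕ, Squarefree m → (∀ r ∈ m.primeFactors, ¬ r ∣ N ∧ (Ideal.span {(r : 𝓞 K)}).IsPrime) →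
      ∀ [NumberField (ringClassField K ι m)] (w : HeightOneSpectrum (𝓞 (ringClassField K ι m))),
        ((q : ℕ) : 𝓞 (ringClassField K ι m)) ∈ w.asIdeal →
        (placeIntModel W (ringClassField K ι m) w).HasNonsingularReduction (K := ringClassField K ι m) (n' • ys m) :=
  labelE0Prime_at_splitCarrier_of_linear W ι hK hp5 hqN hS1 (auxiliaryInertLevel_of_laws W K ι hK hqN hS2 hS3) ys hLab htam

/-- **The binder `hE0T` from the LEAF statements S1-lin, S2♭, (C), (O) on a `p ≥ 5` Shimura frame** (`hsp`: every prime of `N` outside `S` splits in `K`;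
`N ≠ 0`): S3♭ by `auxiliaryPrimeSupply_of_CO` from (C), (O), then `labelE0Prime_at_splitCarrier_of_linearLaws` at each carrier (split multiplicative
by Kodaira–Néron, `c_q ≤ 4 < p` otherwise). [cite: GrossLMS1991, §6 proof of Prop. 6.2 (1), p. 245] [cite: Cox2013, §7.D, Thm. 8.12] -/
theorem carrierLabelsE0Prime_of_linearLeaves [∀ j : ℕ, NumberField (ringClassField K ι j)]
    (hK : IsImaginaryQuadratic K) {p : ℕ} [Fact p.Prime] (hp5 : 5 ≤ p) {N : ℕ} (hN : N ≠ 0) {S : Finset ℕ}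
    (hsp : ∀ ℓ : ℕ, ℓ.Prime → ℓ ∣ N → ℓ ∉ S → ((Ideal.span {(ℓ : ℤ)}).primesOver (𝓞 K)).ncard = 2)
    (hS1 : ∀ (q : ℕ) [Fact q.Prime], W.HasSplitMultiplicativeReductionAtPrime q →
      ((Ideal.span {(q : ℤ)}).primesOver (𝓞 K)).ncard = 2 → TateComponentFamilyLinear W K ι q)
    (hS2 : ∀ (q : ℕ) [Fact q.Prime], RelativeStabilizerLaw K ι q)
    (hC : ChebotarevKummerSupply W K p)
    (hO : ∀ (q : ℕ) [Fact q.Prime], ((Ideal.span {(q : ℤ)}).primesOver (𝓞 K)).ncard = 2 → SplitPrimeKummerWitness K p q)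
    (ys : (m : ℕ) → (W.baseChange (ringClassField K ι m)).toAffine.Point)
    {y : (W.baseChange K).toAffine.Point} {ε : ℤ} (hLab : ShimuraWalk.LabelsAt W N K ι y ys ε) :
    ∀ (q : ℕ) [Fact q.Prime], q ∣ N → q ∉ S → p ∣ (W.baseChange ℚ_[q]).localTamagawaNumber ℤ_[q] →
      ∃ n' : ℕ, ¬ p ∣ n' ∧ ∀ m : ℕ, Squarefree m → (∀ r ∈ m.primeFactors, ¬ r ∣ N ∧ (Ideal.span {(r : 𝓞 K)}).IsPrime) →
        ∀ [NumberField (ringClassField K ι m)] (w : HeightOneSpectrum (𝓞 (ringClassField K ι m))),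
          ((q : ℕ) : 𝓞 (ringClassField K ι m)) ∈ w.asIdeal →
          (placeIntModel W (ringClassField K ι m) w).HasNonsingularReduction (K := ringClassField K ι m) (n' • ys m) := by
  intro q _ hqN hqS htam
  haveI : (W.baseChange ℚ_[q]).IsElliptic := inferInstanceAs (W.map (algebraMap ℚ ℚ_[q])).IsElliptic
  have hs : W.HasSplitMultiplicativeReductionAtPrime q :=
    hasSplitMultiplicativeReduction_of_five_le_of_dvd_localTamagawaNumber q (W.baseChange ℚ_[q]) hp5 htam
  have hq2 : ((Ideal.span {(q : ℤ)}).primesOver (𝓞 K)).ncard = 2 := hsp q Fact.out hqN hqS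
  exact labelE0Prime_at_splitCarrier_of_linearLaws W ι hK hp5 hqN (hS1 q hs hq2) (hS2 q)
    (auxiliaryPrimeSupply_of_CO W K hN hC (hO q hq2)) ys hLab htam

/-- **The binder `hE0T` from THREE leaf statements S1-lin, (C), (O)** — S2♭ is the tree theorem `AuxNormReceptacle.relativeStabilizerLaw`
(width seat -w4 g8, p642411). This is the form skeleton v15 of line `birth` consumes. [cite: GrossLMS1991, §6 p. 245] [cite: NeukirchANT1999, Ch. VI §7 Thm. (7.3)] -/
theorem carrierLabelsE0Prime_of_threeLeaves [∀ j : ℕ, NumberField (ringClassField K ι j)]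
    (hK : IsImaginaryQuadratic K) {p : ℕ} [Fact p.Prime] (hp5 : 5 ≤ p) {N : ℕ} (hN : N ≠ 0) {S : Finset ℕ}
    (hsp : ∀ ℓ : ℕ, ℓ.Prime → ℓ ∣ N → ℓ ∉ S → ((Ideal.span {(ℓ : ℤ)}).primesOver (𝓞 K)).ncard = 2)
    (hS1 : ∀ (q : ℕ) [Fact q.Prime], W.HasSplitMultiplicativeReductionAtPrime q →
      ((Ideal.span {(q : ℤ)}).primesOver (𝓞 K)).ncard = 2 → TateComponentFamilyLinear W K ι q)
    (hC : ChebotarevKummerSupply W K p)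
    (hO : ∀ (q : ℕ) [Fact q.Prime], ((Ideal.span {(q : ℤ)}).primesOver (𝓞 K)).ncard = 2 → SplitPrimeKummerWitness K p q)
    (ys : (m : ℕ) → (W.baseChange (ringClassField K ι m)).toAffine.Point)
    {y : (W.baseChange K).toAffine.Point} {ε : ℤ} (hLab : ShimuraWalk.LabelsAt W N K ι y ys ε) :
    ∀ (q : ℕ) [Fact q.Prime], q ∣ N → q ∉ S → p ∣ (W.baseChange ℚ_[q]).localTamagawaNumber ℤ_[q] →
      ∃ n' : ℕ, ¬ p ∣ n' ∧ ∀ m : ℕ, Squarefree m → (∀ r ∈ m.primeFactors, ¬ r ∣ N ∧ (Ideal.span {(r : 𝓞 K)}).IsPrime) →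
        ∀ [NumberField (ringClassField K ι m)] (w : HeightOneSpectrum (𝓞 (ringClassField K ι m))),
          ((q : ℕ) : 𝓞 (ringClassField K ι m)) ∈ w.asIdeal →
          (placeIntModel W (ringClassField K ι m) w).HasNonsingularReduction (K := ringClassField K ι m) (n' • ys m) :=
  carrierLabelsE0Prime_of_linearLeaves W ι hK hp5 hN hsp hS1 (fun q _ ↦ relativeStabilizerLaw hK ι q) hC hO ys hLab

end Composition

end Summit.BirchSwinnertonDyer.BirchSwinnertonDyer.Theorems.AuxNormReceptacle

end
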